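import Summits.QuantumFields.YangMills.Theorems.BalabanUVNodesN16KingModelTwoRunDerivSup
import Summits.QuantumFields.YangMills.Theorems.BalabanUVNodesN16KingModelTwoRunHolder

/-!
# Route «BalabanUVNodes» (K3⁵ `SpineGivenEndpointR13SepCoP`), DAG node N16 = NE3 — THE KING-MODEL RUNG OF NE3, ALL THREE PRINTED
# CURRENCIES AT ONCE: value, first difference AND Hölder modulus of the two-run minimiser discrepancy `D = φ_K^ψ − Q_nφ_{K+n}^ψ` with ONE
# level-free and volume-free constant — the scalar template of the NE3 root of record AND of this seat's Hölder root `CovRootHolder β`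

Cell `pub-ymgap`, seat `pub-ymgap-dag-n16-c` (R134 acceleration seat, strategy s1; HUMAN RULING D-0062; chair R424 venue), generation 8.
`--kind proof --supports stmt-QuantumFields-20296 --as helper` (K3⁵, plan g68 KEY-20 ∕ dag-lead WORDS-141).  `bears_on: R4∕N16 · row «R2^ϱ,
the unprinted core»`.

WHY THIS FILE.  One statement a reader of row N16 can hold against the decls of record.  `NE3EnergyWeightedCovShape.NE3EnergyRateWCov`
(β = 1) and this seat's `N16HolderDefs.CovRootHolder β` ask, per level, for a two-run discrepancy direction `Z` that is SMALL at a geometric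
rate, whose FIRST (covariant) DIFFERENCES are one power of `ξ = L^{−k}` smaller (Lip₁ᶜ), and — in the Hölder wording N05's leaf supplies
and NE7 consumes — whose `β`-Hölder modulus carries the same rate.  In King's `A = 0` scalar model all three are now kernel theorems
for King's ACTUAL operators (generation 7: value; generation 8: derivative and Hölder lines); this file packages them with ONE constant.

WHAT THIS FILE PROVES (kernel; 2 theorems, 0 `def`, 0 sorry):
* `eq_zero_of_tdistT_add_eq_zero` — on a torus `Π_μ ℤ∕K_μ`, `tdistT K x (x + v) = 0 ⇒ v = 0` (so a zero Hölder distance forces a zero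
  difference; used to state the Hölder clause WITHOUT a positivity proviso).
* ★★ `twoRun_threeCurrencies_le_sup` — for `d ≥ 1`, odd `L ≥ 2`, `a, m² > 0`, `0 < α`, `0 < γ`, `α + γ ≤ 1` there is `C ≥ 0` (a function
  of `d, L, a, m², γ, α` only) such that for EVERY volume `P = (d, L, m, K)` of the `B1∕B4` tower with `K ≥ 1`, every `n ≥ 1`, every datum
  `|ψ| ≤ S`, every coarse point `x`, direction `μ` and coarse vector `v`, writing `D = φ_K^ψ − Q_nφ_{K+n}^ψ`, `θ = L^{−γ∕2}` and
  `ρ = holdist L^K M x (x + v)` (sup torus distance in unit coordinates):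
  (value) `|D(x)| ≤ C·θ^K·S` · (first difference) `|D(x + e_μ) − D(x)| ≤ C·(L^K)⁻¹·θ^K·S` · (Hölder) `|D(x) − D(x + v)| ≤ C·ρ^α·θ^K·S` —
  `N16KingModelDerivSup.twoRun_value_and_firstDiff_le_sup` + `N16KingModelHolder.twoRunHolder_minimiser_blockMean_le_sup` BY NAME, the
  Hölder weight multiplied out (`N16KingModelDeriv.abs_le_of_holder_bound` when `ρ > 0`, the first lemma when `ρ = 0`).

HONEST FRAMING.  A MODEL LAYER (template literature: [King1986] printed AND proved; re-proved in kernel from the tree's King files BY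
NAME).  NOTHING of [Balaban1985RegularSpaces] ∕ [Balaban1985Variational] is proved or discharged; N16 ∕ NE3 is NOT discharged (in-edges
N05, N07 remain hypotheses of the chain of record); COUNT UNMOVED; count-neutral; one finite torus at a time — NOT ℝ⁴, NOT infinite
volume, NOT OS, NOT a mass gap, NOT Clay.  NOT CARRIED by the model: the gauge `u`, the transport `Ad(W)`, the covariant block average,
the energy currency `energyNormW`, (Lip₂′ᶜ), Bałaban's axial constraint.

Sources: C. King, *The U(1) Higgs model. I. The continuum limit*, Commun. Math. Phys. **102** (1986) 649–677 [King1986], Prop. 3.8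
(3.71) p. 664 (lines 1–4), Thm 3.3 (3.7)–(3.8) p. 658, p. 674; T. Bałaban, *Regularity and decay of lattice Green's functions*, Commun.
Math. Phys. **89** (1983) 571–597 [Balaban1983RegularityDecay], Thm (1.10) p. 573.
-/

set_option autoImplicit false

noncomputable section

open Real Finset
open scoped BigOperators

namespace Summit.QuantumFields.YangMills.BalabanUVNodes.N16KingModelPattern

open Literature.MathematicalPhysics.QuantumFieldTheory.Balaban1983to89 (Params)
open Literature.MathematicalPhysics.QuantumFieldTheory.Balaban1983to89.B5Prop11Plancherel (Tor fine unitVec)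
open Literature.MathematicalPhysics.QuantumFieldTheory.Balaban1983to89.B4TorusKernel.MultiPeriod (circAbs circAbs_nonneg)
open Literature.MathematicalPhysics.QuantumFieldTheory.Balaban1983to89.B4Sect5Proof (latticeConst latticeConst_nonneg)
open Literature.MathematicalPhysics.QuantumFieldTheory.King1986
  (aK lemma43Const fprop38RateConst fprop38PosConst aliasConst)
open Literature.MathematicalPhysics.QuantumFieldTheory.King1986.Torus
  (minimiser tdistT tdistT_nonneg circAbs_le_tdistT holdist)
open Summit.QuantumFields.YangMills.BalabanUVNodes.N18KingModel (kingTheta_pos)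
open Summit.QuantumFields.YangMills.BalabanUVNodes.N16KingModelTranslate (circAbs_coord_add)
open Summit.QuantumFields.YangMills.BalabanUVNodes.N16KingModelDeriv (abs_le_of_holder_bound)
open Summit.QuantumFields.YangMills.BalabanUVNodes.N16KingModelDerivSup (twoRun_value_and_firstDiff_le_sup)
open Summit.QuantumFields.YangMills.BalabanUVNodes.N16KingModelHolder (twoRunHolder_minimiser_blockMean_le_sup)

variable {d : ℕ}

/-- **A zero torus distance to a translate forces the translation to vanish**: `tdistT K x (x + v) = 0 ⇒ v = 0` (each circular coordinate
distance `dist(v_ν, K_νℤ)` vanishes and `0 ≤ v_ν < K_ν`). [folklore] -/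
theorem eq_zero_of_tdistT_add_eq_zero {K : Fin d → ℕ} [∀ μ, NeZero (K μ)] (x v : Tor K) (h : tdistT K x (x + v) = 0) : v = 0 := by
  funext ν
  have hK1 : 1 ≤ K ν := Nat.one_le_iff_ne_zero.mpr (NeZero.ne (K ν))
  have hle := circAbs_le_tdistT K x (x + v) ν
  rw [h, circAbs_coord_add] at hle
  have hge : (0 : ℝ) ≤ (circAbs (K ν) ((v ν).val : ℤ) : ℝ) := by exact_mod_cast circAbs_nonneg hK1 _
  have hz : circAbs (K ν) ((v ν).val : ℤ) = 0 := by exact_mod_cast le_antisymm hle hge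
  have hlt : (v ν).val < K ν := ZMod.val_lt _
  have hmod : ((v ν).val : ℤ) % (K ν : ℤ) = (v ν).val := Int.emod_eq_of_lt (by positivity) (by exact_mod_cast hlt)
  unfold circAbs at hz
  rw [hmod] at hz
  have hval : (v ν).val = 0 := by
    rcases min_choice ((v ν).val : ℤ) ((K ν : ℤ) - (v ν).val) with hm | hm <;> rw [hm] at hz <;> omega
  rw [Pi.zero_apply]
  exact (ZMod.val_eq_zero _).1 hval

/-- ★★ **THE NE3 ∕ `CovRootHolder` PATTERN IN KING's MODEL — VALUE, FIRST DIFFERENCE AND HÖLDER MODULUS OF THE TWO-RUN DISCREPANCY, ONE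
LEVEL- AND VOLUME-FREE CONSTANT.**  For `d ≥ 1`, odd `L ≥ 2`, `a, m² > 0`, `0 < α`, `0 < γ`, `α + γ ≤ 1` there is `C ≥ 0` (a function of
`d, L, a, m², γ, α` only) such that for EVERY volume `P = (d, L, m, K)` of the `B1∕B4` tower with `K ≥ 1`, every `n ≥ 1`, every datum
`|ψ| ≤ S`, every coarse point `x`, direction `μ` and coarse vector `v`, the two-run discrepancy `D = φ_K^ψ − Q_nφ_{K+n}^ψ` (run A's minimiser
minus run B's minimiser block-averaged back; King's ACTUAL operators) obeys, with `θ = L^{−γ∕2} < 1` and `ρ = holdist L^K M x (x + v)`: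
`|D(x)| ≤ C·θ^K·S` (value), `|D(x + e_μ) − D(x)| ≤ C·(L^K)⁻¹·θ^K·S` (first difference: ONE POWER of the lattice spacing better — (Lip₁ᶜ)'s
pattern) and `|D(x) − D(x + v)| ≤ C·ρ^α·θ^K·S` (Hölder-`α` modulus with the rate — `CovRootHolder`'s pattern).
[cite: King1986, Prop. 3.8 (3.71) p.664 (lines 1–4), Thm 3.3 (3.7)–(3.8) p.658, p.674] -/
theorem twoRun_threeCurrencies_le_sup (dd L : ℕ) (hd : 1 ≤ dd) (hLodd : Odd L) (hL : 2 ≤ L) {a m2 : ℝ} (ha : 0 < a)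
    (hm : 0 < m2) {α γ : ℝ} (hα : 0 < α) (hγ : 0 < γ) (hαγ : α + γ ≤ 1) :
    ∃ C : ℝ, 0 ≤ C ∧
      ∀ (P : Params) (_hPd : P.d = dd) (_hPL : P.L = L) (_hK : 1 ≤ P.K) [NeZero P.L]
      (n : ℕ) (_hn : 1 ≤ n) (M : Fin P.d → ℕ) [∀ μ, NeZero (M μ)] (_hMK : ∀ μ, M μ = P.sitesPerDir P.K)
      (ψ : Tor M → ℝ) (S : ℝ) (_hS : ∀ b, |ψ b| ≤ S) (xt : Tor (fine (P.L ^ P.K) M)) (μ : Fin P.d)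
      (v : Tor (fine (P.L ^ P.K) M)),
      |minimiser (P.L ^ P.K) M (aK a P.L P.K) (((P.L ^ P.K : ℕ) : ℝ) ^ 2) m2 ψ xt
          - (((Finset.univ.filter fun x' : Tor (fine (P.L ^ n * P.L ^ P.K) M) =>
                ∀ ν, (xt ν).val = (x' ν).val / P.L ^ n).card : ℝ))⁻¹ *
            ∑ x' ∈ (Finset.univ.filter fun x' : Tor (fine (P.L ^ n * P.L ^ P.K) M) =>
                ∀ ν, (xt ν).val = (x' ν).val / P.L ^ n),
              minimiser (P.L ^ n * P.L ^ P.K) M (aK a P.L (P.K + n)) (((P.L ^ n * P.L ^ P.K : ℕ) : ℝ) ^ 2) m2 ψ x'|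
        ≤ C * ((L : ℝ) ^ (-(γ / 2))) ^ P.K * S ∧
      |(minimiser (P.L ^ P.K) M (aK a P.L P.K) (((P.L ^ P.K : ℕ) : ℝ) ^ 2) m2 ψ (xt + unitVec (fine (P.L ^ P.K) M) μ)
            - (((Finset.univ.filter fun y : Tor (fine (P.L ^ n * P.L ^ P.K) M) =>
                  ∀ ν, ((xt + unitVec (fine (P.L ^ P.K) M) μ) ν).val = (y ν).val / P.L ^ n).card : ℝ))⁻¹ *
              ∑ y ∈ (Finset.univ.filter fun y : Tor (fine (P.L ^ n * P.L ^ P.K) M) =>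
                  ∀ ν, ((xt + unitVec (fine (P.L ^ P.K) M) μ) ν).val = (y ν).val / P.L ^ n),
                minimiser (P.L ^ n * P.L ^ P.K) M (aK a P.L (P.K + n)) (((P.L ^ n * P.L ^ P.K : ℕ) : ℝ) ^ 2) m2 ψ y)
          - (minimiser (P.L ^ P.K) M (aK a P.L P.K) (((P.L ^ P.K : ℕ) : ℝ) ^ 2) m2 ψ xt
            - (((Finset.univ.filter fun x' : Tor (fine (P.L ^ n * P.L ^ P.K) M) =>
                  ∀ ν, (xt ν).val = (x' ν).val / P.L ^ n).card : ℝ))⁻¹ *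
              ∑ x' ∈ (Finset.univ.filter fun x' : Tor (fine (P.L ^ n * P.L ^ P.K) M) =>
                  ∀ ν, (xt ν).val = (x' ν).val / P.L ^ n),
                minimiser (P.L ^ n * P.L ^ P.K) M (aK a P.L (P.K + n)) (((P.L ^ n * P.L ^ P.K : ℕ) : ℝ) ^ 2) m2 ψ x')|
        ≤ C * (((L : ℝ) ^ P.K))⁻¹ * ((L : ℝ) ^ (-(γ / 2))) ^ P.K * S ∧
      |(minimiser (P.L ^ P.K) M (aK a P.L P.K) (((P.L ^ P.K : ℕ) : ℝ) ^ 2) m2 ψ xt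
            - (((Finset.univ.filter fun x' : Tor (fine (P.L ^ n * P.L ^ P.K) M) =>
                  ∀ ν, (xt ν).val = (x' ν).val / P.L ^ n).card : ℝ))⁻¹ *
              ∑ x' ∈ (Finset.univ.filter fun x' : Tor (fine (P.L ^ n * P.L ^ P.K) M) =>
                  ∀ ν, (xt ν).val = (x' ν).val / P.L ^ n),
                minimiser (P.L ^ n * P.L ^ P.K) M (aK a P.L (P.K + n)) (((P.L ^ n * P.L ^ P.K : ℕ) : ℝ) ^ 2) m2 ψ x')
          - (minimiser (P.L ^ P.K) M (aK a P.L P.K) (((P.L ^ P.K : ℕ) : ℝ) ^ 2) m2 ψ (xt + v)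
            - (((Finset.univ.filter fun y : Tor (fine (P.L ^ n * P.L ^ P.K) M) =>
                  ∀ ν, ((xt + v) ν).val = (y ν).val / P.L ^ n).card : ℝ))⁻¹ *
              ∑ y ∈ (Finset.univ.filter fun y : Tor (fine (P.L ^ n * P.L ^ P.K) M) =>
                  ∀ ν, ((xt + v) ν).val = (y ν).val / P.L ^ n),
                minimiser (P.L ^ n * P.L ^ P.K) M (aK a P.L (P.K + n)) (((P.L ^ n * P.L ^ P.K : ℕ) : ℝ) ^ 2) m2 ψ y)|
        ≤ C * (holdist (P.L ^ P.K) M xt (xt + v)) ^ α * ((L : ℝ) ^ (-(γ / 2))) ^ P.K * S := by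
  have hγ1 : γ < 1 := by linarith
  obtain ⟨C₁, hC₁, HVD⟩ := twoRun_value_and_firstDiff_le_sup dd L hd hLodd hL ha hm hγ hγ1
  obtain ⟨δ, c, hδ, hc, HH⟩ := twoRunHolder_minimiser_blockMean_le_sup dd L hd hLodd hL ha hm hα hγ hαγ
  set CH : ℝ := 2 * Real.sqrt (2 * c *
      (fprop38RateConst a a (a * (2 * ((a * (1 - ((L : ℝ) ^ 2)⁻¹))⁻¹ + π ^ 2 / 48 + 1 / 3))) ((π ^ 2 / 4) ^ dd) dd γ α
          (2 * (dd : ℝ) ^ α) 0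
        + fprop38PosConst a ((π ^ 2 / 4) ^ dd) dd γ α (2 * (dd : ℝ) ^ α) (6 * (dd : ℝ) ^ (α + γ))))
      * latticeConst dd (δ / 2) with hCH
  have hCH0 : 0 ≤ CH :=
    mul_nonneg (mul_nonneg (by norm_num) (Real.sqrt_nonneg _)) (latticeConst_nonneg dd (by positivity))
  refine ⟨max C₁ CH, le_max_of_le_left hC₁, ?_⟩
  intro P hPd hPL hK _ n hn M _ hMK ψ S hS xt μ v
  obtain ⟨hV, hD⟩ := HVD P hPd hPL hK n hn M hMK ψ S hS xt μ
  have hH := HH P hPd hPL hK n hn M hMK ψ S hS xt v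
  subst hPd hPL
  have hS0 : 0 ≤ S := (abs_nonneg _).trans (hS 0)
  have hθ : 0 ≤ ((P.L : ℝ) ^ (-(γ / 2))) ^ P.K := pow_nonneg (kingTheta_pos (by omega) (γ / 2)).le _
  have hNinv : 0 ≤ (((P.L : ℝ) ^ P.K))⁻¹ := inv_nonneg.2 (by positivity)
  have hρ0 : 0 ≤ holdist (P.L ^ P.K) M xt (xt + v) := by
    unfold holdist; exact div_nonneg (tdistT_nonneg _ _ _) (Nat.cast_nonneg _)
  refine ⟨hV.trans (mul_le_mul_of_nonneg_right (mul_le_mul_of_nonneg_right (le_max_left _ _) hθ) hS0),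
    hD.trans (mul_le_mul_of_nonneg_right (mul_le_mul_of_nonneg_right
      (mul_le_mul_of_nonneg_right (le_max_left _ _) hNinv) hθ) hS0), ?_⟩
  rcases hρ0.eq_or_lt with hρ | hρ
  · -- zero distance: `v = 0`, the difference vanishes
    have htd : tdistT (fine (P.L ^ P.K) M) xt (xt + v) = 0 := by
      have hN : (0 : ℝ) < ((P.L ^ P.K : ℕ) : ℝ) := by exact_mod_cast pow_pos (show 0 < P.L by omega) P.K
      have h := hρ.symm
      unfold holdist at h
      rw [div_eq_zero_iff] at h
      exact h.resolve_right hN.ne'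
    have hv : v = 0 := eq_zero_of_tdistT_add_eq_zero xt v htd
    subst hv
    rw [add_zero] at hρ0
    rw [add_zero, sub_self, abs_zero]
    exact mul_nonneg (mul_nonneg (mul_nonneg (le_trans hC₁ (le_max_left _ _)) (Real.rpow_nonneg hρ0 _)) hθ) hS0
  · -- positive distance: multiply the Hölder weight out
    have h2 := abs_le_of_holder_bound hρ hH
    refine h2.trans ?_
    have hY : 0 ≤ (holdist (P.L ^ P.K) M xt (xt + v)) ^ α * ((P.L : ℝ) ^ (-(γ / 2))) ^ P.K * S :=
      mul_nonneg (mul_nonneg (Real.rpow_nonneg hρ0 _) hθ) hS0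
    calc CH * ((P.L : ℝ) ^ (-(γ / 2))) ^ P.K * S * (holdist (P.L ^ P.K) M xt (xt + v)) ^ α
        = CH * ((holdist (P.L ^ P.K) M xt (xt + v)) ^ α * ((P.L : ℝ) ^ (-(γ / 2))) ^ P.K * S) := by ring
      _ ≤ max C₁ CH * ((holdist (P.L ^ P.K) M xt (xt + v)) ^ α * ((P.L : ℝ) ^ (-(γ / 2))) ^ P.K * S) :=
          mul_le_mul_of_nonneg_right (le_max_right _ _) hY
      _ = _ := by ring

end Summit.QuantumFields.YangMills.BalabanUVNodes.N16KingModelPattern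

end
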